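import Summits.QuantumFields.BalabanUV.Beta.SymRootedJetTwist
import Summits.QuantumFields.BalabanUV.Beta.SymRootedJetReflectionExpanded
import Summits.QuantumFields.BalabanUV.Beta.RootedT2JetReflection

/-!
# `BalabanUV.Beta.SymRootedT2JetReflection` — THE AXIS-REFLECTION LAWS OF THE (0.4)-SYMMETRISED SECOND-ORDER RESPONSE `symT2At ρ_c` BY COMPONENTS
# (β sub-cell, row D1, TABLES-SYM-LEAN S2c, INTERFACE-LEVEL twin of an3's `RootedT2JetReflection`; an1 gen 43; the border path to (T2-B))

HONEST FRAMING (cell charter, verbatim): «discharging BetaPertH makes Bałaban's UV stability UNCONDITIONAL — a real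
constructive-QFT result; it is NOT the continuum limit and NOT the Clay problem.»  HONEST DEPENDENCY (verbatim): «continuum YM on
T⁴ ⇐ BetaPertH ∧ nine spine estimates (0/9 proved); BetaPertH ⇐ (D1) ∧ (D4) ∧ CAP+tail; G-an2-4 gates asym, D1 and NE2/3/4.»
ABSOLUTE RULE (R-g25-7 ∕ R-D1-g30-1 (A)): the (0.4)-symmetrised averaging is the exp of the MEAN OF LOGS over the pair family
`{loop^{σ,σ′}}` with weight `((d!)²·L^d)⁻¹`; every object below is the comb module's algebra read on an1's `symPhiGAt` (S2b part 1)
instead of `PhiGAt` — STATEMENT FOR STATEMENT under the dictionary `PhiXAt ↦ symPhiXAt`, `XjetAt ↦ symXjetAt`, `MσXAt ↦ symMσXAt`,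
`L^{-d}·linAvgAt ↦ (d!·L^d)⁻¹·symLinU`, `L^{-d}·hessUAt ↦ ((d!)²L^d)⁻¹·symHessUAt`, `L^{-2d}·vhUAt ↦ ((d!)²L^{2d})⁻¹·symVhUAt`
(an3-g63 [AN3-G63-S2C] (C-ii): constants PER BCH ORDER; CONVENTION `(d!)²` un-normalised inside order-2 sym functionals).
FAMILY-INDEPENDENT chart ∕ letter ∕ `Tau`-algebra lemmas of the comb module are imported BY NAME, never re-proved.
DERIVED cell leaf: [folklore] ring algebra; the `sym*` families are [our object]s.  No statement of Bałaban's papers is typed here, no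
`[cite:]` tag, no `Prop` is minted, no binder of the β-function wall (`hW`/`hR`/`D1Tel`/`D1Rep`, (D1), `BetaPertH`) is instantiated or
discharged; nothing about the VALUES of `symMixFFAt`∕`symVh₂SAt` and no (T2-B)∕(T2-M₂) letter is discharged in this file.
NOT D1, NOT BetaPertH, NOT continuum, NOT Clay.  NOT summit progress.
Provenance: β sub-cell, TABLES-SYM-LEAN S2c option (C) (S2C-SCOPE-v1 94facb80ac685517), unit b2b-balaban-beta-an1-g43 (W-supplier AN1,
FREEZE (0): scratch for a courier; an1 files nothing), 2026-08-21; no existing file touched.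

## What this module proves (sym twin of `RootedT2JetReflection` §2–§4; §1 `c11_conj` and `c00_omegaR` are letter algebra, the comb module's BY NAME)
Write `w = R1g α ω`, `b = R1g α B`, `c = R1g α B′`, `ρ_c = ctr d L`, `L` odd, `x′ = bref α α x`.
* §2 `symQjetLAt_reflected` — the reflected symmetrised jet by components (an1's `symQjetLAt_twist`, `symQjetLAt_omegaR`).
* §3 [our object] `symCT` and the μ ≠ α law `symT2At_sref_of_ne`: `symT2At ρ_c ω B B′ μ (sref α y) = symT2At ρ_c w b c μ y + symCT(B,B′) + symCT(B′,B)`.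
* §4 [our objects] `symNR`, `symCJ`, `c00_symNR`, and the μ = α law `symT2At_bref_self`:
  `symT2At ρ_c ω B B′ α y′ = −(symT2At ρ_c w b c α y + symCT + symCT′ + symCJ + symCJ′)`.
-/

namespace Summit.QuantumFields.BalabanUV.Beta.SymRootedT2JetReflection

open Literature.MathematicalPhysics.QuantumFieldTheory.Balaban1983to89
open Literature.MathematicalPhysics.QuantumFieldTheory.Balaban1983to89.Beta
open AffineAveraging (Form1)
open AveragingContoursRooted (ctr)
open AveragingThirdJet (Tau Rho Ebg Ebi)
open AveragingThirdJet.Tau (τ₁ τ₂ τ12 ι c00 c10 c01 c11 ext4)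
open ResolventReflection (sref bref)
open Summit.QuantumFields.BalabanUV.Beta.RootedHolonomyReflection (R1g R1g_of_ne)
open Summit.QuantumFields.BalabanUV.Beta.RootedHolonomyReflectionHol (reflPair)
open Summit.QuantumFields.BalabanUV.Beta.RootedJetReflection (omegaR omegaR_of_ne omegaR_self)
open Summit.QuantumFields.BalabanUV.Beta.SymRootedJetReflection (symPhiLAt symQjetLAt symQjetAt_eq_symQjetLAt symQjetAt_sref_of_ne symQjetAt_bref_self
  fst_symPhiRAt_zero_mul_fst_symPhiLAt_zero)
open Summit.QuantumFields.BalabanUV.Beta.SymAveragingMixedJetTables (symPhiGAt symPhiRAt symQjetAt symT2At)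
open Summit.QuantumFields.BalabanUV.Beta.RootedT2JetReflection (c11_conj c00_omegaR)
open Summit.QuantumFields.BalabanUV.Beta.RootedJetReflectionExpanded (dR dR_swap reflPair_Ebg_Ebi reflPair_Ebi_Ebg ad1R ad12R)
open Summit.QuantumFields.BalabanUV.Beta.SymRootedJetReflectionExpanded (symQjetLAt_omegaR)
open Summit.QuantumFields.BalabanUV.Beta.RootedJetTwist (shadow_eq_Ebg shadow_eq_Ebi)
open Summit.QuantumFields.BalabanUV.Beta.SymRootedJetTwist (symQjetLAt_twist c10_symQjetAt_neg)

variable {𝕜 : Type*} [Field 𝕜] {d : ℕ} {𝔸 : Type*} [Ring 𝔸] [Algebra 𝕜 𝔸]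

/-! ## §1 The `τ₁τ₂`-component of a background conjugation -/

/-! ## §2 The reflected jet by components -/

variable (𝕜) in
/-- [folklore] **THE REFLECTED JET BY COMPONENTS** (any root, any bond direction): the rooted jet of 33D's reflected chart
data `(ω♯; E♯, Ē♯)` equals `Q(w; b, c) + τ₁·Q(ad1R b; b, c) + τ₂·Q(ad1R c; b, c) + τ₁τ₂·Q(ad12R; b, c) + τ₁τ₂·ι(c10 Q♭)`,
`Q♭ = symQjetAt ρ (ι∘c00∘w) (dR) 0` the scalar-shadow jet of the axis twist. -/
theorem symQjetLAt_reflected (ρ : Fin d → ℤ) (α : Fin d) (ω : Form1 d (Tau 𝔸)) (B B' : Form1 d 𝔸) (L : ℕ) (μ : Fin d)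
    (y : Fin d → ℤ) :
    symQjetLAt 𝕜 ρ (omegaR α ω B B') (reflPair α (Ebg B B') (Ebi B B')) (reflPair α (Ebi B B') (Ebg B B')) L μ y
      = symQjetAt 𝕜 ρ (R1g α ω) (R1g α B) (R1g α B') L μ y + τ₁ * symQjetAt 𝕜 ρ (ad1R α ω B) (R1g α B) (R1g α B') L μ y
        + τ₂ * symQjetAt 𝕜 ρ (ad1R α ω B') (R1g α B) (R1g α B') L μ y
        + τ12 * symQjetAt 𝕜 ρ (ad12R α ω B B') (R1g α B) (R1g α B') L μ y
        + τ12 * ι (c10 (symQjetAt 𝕜 ρ (fun κ x => ι (c00 (R1g α ω κ x))) (dR α B B') 0 L μ y)) := by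
  rw [reflPair_Ebg_Ebi, reflPair_Ebi_Ebg, symQjetLAt_twist, shadow_eq_Ebg _ _ (fun κ x => by simp),
    shadow_eq_Ebi _ _ (fun κ x => by simp), symQjetLAt_omegaR, ← symQjetAt_eq_symQjetLAt, ← symQjetAt_eq_symQjetLAt, ← symQjetAt_eq_symQjetLAt,
    ← symQjetAt_eq_symQjetLAt, ← symQjetAt_eq_symQjetLAt]
  simp only [c00_omegaR]

/-! ## §3 The μ ≠ α law -/

variable (𝕜) in
/-- [our object] THE CONTACT COMPONENTS of the reflected jet in its `τ₁τ₂`-slot: `symCT = c01 Q(ad1R b; b,c) + c10 Q(ad1R c; b,c) +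
c00 Q(ad12R(b,c); b,c)`. -/
noncomputable def symCT (ρ : Fin d → ℤ) (α : Fin d) (ω : Form1 d (Tau 𝔸)) (B B' : Form1 d 𝔸) (L : ℕ) (μ : Fin d) (y : Fin d → ℤ) : 𝔸 :=
  c01 (symQjetAt 𝕜 ρ (ad1R α ω B) (R1g α B) (R1g α B') L μ y) + c10 (symQjetAt 𝕜 ρ (ad1R α ω B') (R1g α B) (R1g α B') L μ y)
    + c00 (symQjetAt 𝕜 ρ (ad12R α ω B B') (R1g α B) (R1g α B') L μ y)

section Transverse

variable (𝕜) {L : ℕ} (hL : Odd L)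
include hL

/-- [folklore] **THE μ ≠ α LAW OF `symT2At`**: `symT2At ρ_c ω B B′ μ (sref α y) = symT2At ρ_c w b c μ y + symCT(B,B′) + symCT(B′,B)` — the
axis twists of the two orderings are `c10 Q♭(±dR)` and cancel (33H `c10_symQjetAt_neg`, 33G `dR_swap`). -/
theorem symT2At_sref_of_ne {α μ : Fin d} (h : μ ≠ α) (ω : Form1 d (Tau 𝔸)) (B B' : Form1 d 𝔸) (y : Fin d → ℤ) :
    symT2At 𝕜 (ctr d L) ω B B' L μ (sref α y)
      = symT2At 𝕜 (ctr d L) (R1g α ω) (R1g α B) (R1g α B') L μ y + symCT 𝕜 (ctr d L) α ω B B' L μ y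
        + symCT 𝕜 (ctr d L) α ω B' B L μ y := by
  simp only [symT2At, symCT, symQjetAt_sref_of_ne 𝕜 hL h, symQjetLAt_reflected, AveragingThirdJet.Tau.c11_add,
    AveragingThirdJet.Tau.c11_τ₁_mul, AveragingThirdJet.Tau.c11_τ₂_mul, AveragingThirdJet.Tau.c11_τ12_mul,
    AveragingThirdJet.Tau.c00_ι, dR_swap α B B']
  rw [c10_symQjetAt_neg]
  abel

end Transverse

/-! ## §4 The μ = α law -/

variable (𝕜) in
/-- [our object] THE BACKGROUND OF THE REFLECTED FLUCTUATION-FREE AVERAGING: `symNR = (symPhiLAt ρ 0 E♯ Ē♯ L μ y).fst` (33D's `P₀`). -/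
noncomputable def symNR (ρ : Fin d → ℤ) (α : Fin d) (B B' : Form1 d 𝔸) (L : ℕ) (μ : Fin d) (y : Fin d → ℤ) : Tau 𝔸 :=
  (symPhiLAt 𝕜 ρ 0 (reflPair α (Ebg B B') (Ebi B B')) (reflPair α (Ebi B B') (Ebg B B')) L μ y).fst

variable (𝕜) in
/-- [our object] THE CONJUGATION COMPONENTS: the six extra terms of §1 for `X` = the reflected jet of §2 and `n = symNR`, with
`X₀₁ = c01 Q(w) + c00 Q(ad1R c)`, `X₁₀ = c10 Q(w) + c00 Q(ad1R b)`, `X₀₀ = c00 Q(w)` (backgrounds `(b, c)` throughout). -/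
noncomputable def symCJ (ρ : Fin d → ℤ) (α : Fin d) (ω : Form1 d (Tau 𝔸)) (B B' : Form1 d 𝔸) (L : ℕ) (μ : Fin d) (y : Fin d → ℤ) : 𝔸 :=
  -(c10 (symNR 𝕜 ρ α B B' L μ y)
        * (c01 (symQjetAt 𝕜 ρ (R1g α ω) (R1g α B) (R1g α B') L μ y) + c00 (symQjetAt 𝕜 ρ (ad1R α ω B') (R1g α B) (R1g α B') L μ y))
      - (c01 (symQjetAt 𝕜 ρ (R1g α ω) (R1g α B) (R1g α B') L μ y) + c00 (symQjetAt 𝕜 ρ (ad1R α ω B') (R1g α B) (R1g α B') L μ y))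
        * c10 (symNR 𝕜 ρ α B B' L μ y))
    - (c01 (symNR 𝕜 ρ α B B' L μ y)
        * (c10 (symQjetAt 𝕜 ρ (R1g α ω) (R1g α B) (R1g α B') L μ y) + c00 (symQjetAt 𝕜 ρ (ad1R α ω B) (R1g α B) (R1g α B') L μ y))
      - (c10 (symQjetAt 𝕜 ρ (R1g α ω) (R1g α B) (R1g α B') L μ y) + c00 (symQjetAt 𝕜 ρ (ad1R α ω B) (R1g α B) (R1g α B') L μ y))
        * c01 (symNR 𝕜 ρ α B B' L μ y))
    - (c11 (symNR 𝕜 ρ α B B' L μ y) * c00 (symQjetAt 𝕜 ρ (R1g α ω) (R1g α B) (R1g α B') L μ y)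
      - c00 (symQjetAt 𝕜 ρ (R1g α ω) (R1g α B) (R1g α B') L μ y) * c11 (symNR 𝕜 ρ α B B' L μ y))
    + (c10 (symNR 𝕜 ρ α B B' L μ y) * c01 (symNR 𝕜 ρ α B B' L μ y) + c01 (symNR 𝕜 ρ α B B' L μ y) * c10 (symNR 𝕜 ρ α B B' L μ y))
      * c00 (symQjetAt 𝕜 ρ (R1g α ω) (R1g α B) (R1g α B') L μ y)
    - c10 (symNR 𝕜 ρ α B B' L μ y) * c00 (symQjetAt 𝕜 ρ (R1g α ω) (R1g α B) (R1g α B') L μ y) * c01 (symNR 𝕜 ρ α B B' L μ y)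
    - c01 (symNR 𝕜 ρ α B B' L μ y) * c00 (symQjetAt 𝕜 ρ (R1g α ω) (R1g α B) (R1g α B') L μ y) * c10 (symNR 𝕜 ρ α B B' L μ y)

/-- [folklore] `c00 symNR = 1` (augmentation-one letters average to an augmentation-one element). -/
theorem c00_symNR (ρ : Fin d → ℤ) (α : Fin d) (B B' : Form1 d 𝔸) (L : ℕ) (μ : Fin d) (y : Fin d → ℤ) :
    c00 (symNR 𝕜 ρ α B B' L μ y) = 1 := by
  have h : AveragingThirdJet.augR 𝕜
      (symPhiLAt 𝕜 ρ 0 (reflPair α (Ebg B B') (Ebi B B')) (reflPair α (Ebi B B') (Ebg B B')) L μ y) = 1 :=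
    Summit.QuantumFields.BalabanUV.Beta.SymRootedJetDictionary.aug_symPhiGAt_eq_one
      (fun κ x => by simp [AveragingThirdJet.augR_apply, Summit.QuantumFields.BalabanUV.Beta.RootedJetReflection.fst_GfL,
        reflPair_Ebg_Ebi])
      (fun κ x => by simp [AveragingThirdJet.augR_apply, Summit.QuantumFields.BalabanUV.Beta.RootedJetReflection.fst_GbL,
        reflPair_Ebi_Ebg]) ρ L μ y
  simpa [symNR, AveragingThirdJet.augR_apply] using h

section Longitudinal

variable (𝕜) {L : ℕ} (hL : Odd L) (h2 : (2 : 𝕜) ≠ 0)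
include hL h2

/-- [folklore] **THE μ = α LAW OF `symT2At`**: on the reflected axis bond,
`symT2At ρ_c ω B B′ α (bref α α y) = −(symT2At ρ_c w b c α y + symCT(B,B′) + symCT(B′,B) + symCJ(B,B′) + symCJ(B′,B))`. -/
theorem symT2At_bref_self (α : Fin d) (ω : Form1 d (Tau 𝔸)) (B B' : Form1 d 𝔸) (y : Fin d → ℤ) :
    symT2At 𝕜 (ctr d L) ω B B' L α (bref α α y)
      = -(symT2At 𝕜 (ctr d L) (R1g α ω) (R1g α B) (R1g α B') L α y + symCT 𝕜 (ctr d L) α ω B B' L α y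
          + symCT 𝕜 (ctr d L) α ω B' B L α y + symCJ 𝕜 (ctr d L) α ω B B' L α y + symCJ 𝕜 (ctr d L) α ω B' B L α y) := by
  have e1 := c11_conj (fst_symPhiRAt_zero_mul_fst_symPhiLAt_zero 𝕜 hL h2 α B B' y) (c00_symNR (𝕜 := 𝕜) (ctr d L) α B B' L α y)
    (symQjetLAt 𝕜 (ctr d L) (omegaR α ω B B') (reflPair α (Ebg B B') (Ebi B B')) (reflPair α (Ebi B B') (Ebg B B')) L α y)
  have e2 := c11_conj (fst_symPhiRAt_zero_mul_fst_symPhiLAt_zero 𝕜 hL h2 α B' B y) (c00_symNR (𝕜 := 𝕜) (ctr d L) α B' B L α y)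
    (symQjetLAt 𝕜 (ctr d L) (omegaR α ω B' B) (reflPair α (Ebg B' B) (Ebi B' B)) (reflPair α (Ebi B' B) (Ebg B' B)) L α y)
  rw [symT2At, symQjetAt_bref_self 𝕜 hL h2, symQjetAt_bref_self 𝕜 hL h2, AveragingThirdJet.Tau.c11_neg, AveragingThirdJet.Tau.c11_neg,
    e1, e2]
  simp only [symQjetLAt_reflected, symCT, symCJ, symNR, symT2At, AveragingThirdJet.Tau.c11_add, AveragingThirdJet.Tau.c01_add,
    AveragingThirdJet.Tau.c10_add, AveragingThirdJet.Tau.c00_add, AveragingThirdJet.Tau.c11_τ₁_mul,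
    AveragingThirdJet.Tau.c11_τ₂_mul, AveragingThirdJet.Tau.c11_τ12_mul, AveragingThirdJet.Tau.c01_τ₁_mul,
    AveragingThirdJet.Tau.c01_τ₂_mul, AveragingThirdJet.Tau.c01_τ12_mul, AveragingThirdJet.Tau.c10_τ₁_mul,
    AveragingThirdJet.Tau.c10_τ₂_mul, AveragingThirdJet.Tau.c10_τ12_mul, AveragingThirdJet.Tau.c00_τ₁_mul,
    AveragingThirdJet.Tau.c00_τ₂_mul, AveragingThirdJet.Tau.c00_τ12_mul, AveragingThirdJet.Tau.c00_ι, add_zero,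
    dR_swap α B B']
  rw [c10_symQjetAt_neg]
  abel

end Longitudinal

end Summit.QuantumFields.BalabanUV.Beta.SymRootedT2JetReflection
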